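import Summits.CriticalPhenomena.PercolationContinuityZ3.Theorems.Transplant.FKDoubleFanWedge
import HarnessLib

/-!
# Double fans `K₂ ∨ P_{m+1}`: the fixed points of `T_D ∘ T_a` on the face `{N_bc = 0}` and the obstruction to polyhedral invariant cones

Helper file (`--supports stmt-CriticalPhenomena-4575`), FK sub-lane `prim-bschramm-fk-3` (gen 30); builds on p205010 (kernel theorem, internal
audit signed; external expert review pending).  Pure linear algebra over `ℝ`; no named facts, no sorries; standard axioms.
Memo `bschramm/prim-bschramm-fk-3/FAR-CROSS-V.md` §0(C)–(D), §5.

The termwise route of `…DoubleFanWedge` / `…DoubleFanWedgeWord` asks for a convex cone of bivectors stable under the six operators, containing the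
input pair bivectors `u ∧ P_a u` and pairing non-negatively with the target pair bivectors `s ∧ P_b s`.  This file records the exact algebra behind
the memo's NO-GO THEOREM for finitely generated (polyhedral) such cones:
* **`bivFaceB`** `= (ux:1, uv:1, xz:−(2−q), zv:2−q)` and **`bivFaceA`** `= (uy:−1, uz:1−q, yz:2−q)` are FIXED POINTS of `T_D ∘ T_a`
  (**`opTD_opTa_faceB`**, **`opTD_opTa_faceA`**), and the face tangent **`bivFaceT`** `= (uv:1, zv:2−q)` is mapped onto `bivFaceB` in one step
  (**`opTD_opTa_faceT`**); the input ray `e_xv` (**`bivXV`**, the bivector of the axis letter `AB_1`) is a joint eigenvector: `T_a e_xv = e_xv`,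
  `T_D e_xv = q·e_xv` (**`opTa_bivXV`**, **`opTD_bivXV`**).
* Against the `b`-pinned target bivector of ANY rest `s`:  `⟪bivFaceB, s∧P_b s⟫ = −(1−q)(2−q)(κ_a(s) + q·x̂ẑ)` (**`pairH_faceB_target`**),
  `⟪bivFaceA, s∧P_b s⟫ = −(1−q)²(2−q)·ẑ(ŷ − (1−q)Z_0)` (**`pairH_faceA_target`**), `⟪e_xv, s∧P_b s⟫ = (1−q)·x̂v̂` (**`pairH_bivXV_target`**);
  the first two are `≤ 0` for every valid `s` and `0 ≤ q ≤ 1` (**`pairH_faceB_target_nonpos`**, **`pairH_faceA_target_nonpos`**).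
* Consequently (**`iterate_opTD_opTa_face`**, **`pairH_iterate_face_delta0`**) `(T_D T_a)^{k+1}(e_xv + m·bivFaceT) = q^{k+1}·e_xv + m·bivFaceB` pairs with the
  `δ_0` target as `(1−q)q(q^k − m(2−q))`, which is negative as soon as `q^k < m(2−q)`; hence (**`exists_neg_pairing_of_face_tangent_mem`**) ANY set of
  bivectors closed under `T_D` and `T_a` that contains a point `e_xv + m·bivFaceT` with `m > 0` contains an element pairing negatively with the `δ_0` target
  (`0 < q < 1`).  Since every polyhedral cone containing the inputs `{u ∧ P_a u : u valid, U}` contains such a point (memo §0(D): tangential shadow of the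
  `U_b`-tight degenerate family at `e_xv`), no finitely generated `{T_D, T_a}`-stable cone can carry the termwise route; the memo's PATH C (a cone with a
  second-order-cone boundary piece) is forced.
[cite: Grimmett2006, §3.9 eq. (3.94) (pp. 63–64)] [folklore]
-/

noncomputable section

namespace Summit.CriticalPhenomena.PercolationContinuityZ3.Theorems

namespace FK

namespace ThreeApex

/-! ### The four special bivectors -/

/-- The fixed point `A` of `T_D ∘ T_a` on the face `{N_bc = 0}` (scaled by `p = 1−q`): `(uy: −1, uz: 1−q, yz: 2−q)`. [folklore] -/
def bivFaceA (q : ℝ) : Biv := ⟨0, -1, 1 - q, 0, 0, 0, 0, 2 - q, 0, 0⟩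

/-- The fixed point `B` of `T_D ∘ T_a`: `(ux: 1, uv: 1, xz: −(2−q), zv: 2−q)`. [folklore] -/
def bivFaceB (q : ℝ) : Biv := ⟨1, 0, 0, 1, 0, -(2 - q), 0, 0, 0, 2 - q⟩

/-- The face tangent `T_deg = (uv: 1, zv: 2−q)` at `e_xv` of the `U_b`-tight degenerate input family (`N_bc(T_deg) = 0`, `κ_c(T_deg) = 1`). [folklore] -/
def bivFaceT (q : ℝ) : Biv := ⟨0, 0, 0, 1, 0, 0, 0, 0, 0, 2 - q⟩

/-- The input ray `e_xv` (the pair bivector of the axis letter `AB_1`, end point `s = 0` of the arc `β(s)`). [folklore] -/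
def bivXV : Biv := ⟨0, 0, 0, 0, 0, 0, 1, 0, 0, 0⟩

/-- `T_D (T_a A) = A`. [folklore] -/
theorem opTD_opTa_faceA (q : ℝ) : opTD q (opTa (bivFaceA q)) = bivFaceA q := by
  ext <;> simp only [opTD, opTa, bivFaceA] <;> ring

/-- `T_D (T_a B) = B`. [folklore] -/
theorem opTD_opTa_faceB (q : ℝ) : opTD q (opTa (bivFaceB q)) = bivFaceB q := by
  ext <;> simp only [opTD, opTa, bivFaceB] <;> ring

/-- `T_D (T_a T_deg) = B`: the face tangent lands on the fixed point in one step. [folklore] -/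
theorem opTD_opTa_faceT (q : ℝ) : opTD q (opTa (bivFaceT q)) = bivFaceB q := by
  ext <;> simp only [opTD, opTa, bivFaceT, bivFaceB] <;> ring

/-- `T_a e_xv = e_xv`. [folklore] -/
theorem opTa_bivXV : opTa bivXV = bivXV := by
  ext <;> simp [opTa, bivXV]

/-- `T_D e_xv = q·e_xv`. [folklore] -/
theorem opTD_bivXV (q : ℝ) : opTD q bivXV = Biv.smul q bivXV := by
  ext <;> simp [opTD, bivXV, Biv.smul]

/-! ### Pairings with the `b`-pinned target bivector `s ∧ P_b s` -/

/-- `⟪B, s∧P_b s⟫ = −(1−q)(2−q)(κ_a(s) + q·x̂(s)ẑ(s))`. [folklore] -/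
theorem pairH_faceB_target (q : ℝ) (s : V5) :
    pairH q (bivFaceB q) (wedgeH (conv (edgeBC 0) s) (conv (edgeBC 1) s)) = -((1 - q) * (2 - q)) * (kap s + q * hx s * hz s) := by
  simp only [pairH, bivFaceB, wedgeH, conv, edgeBC, kap, hx, hy, hz, V5.total]; ring

/-- `⟪A, s∧P_b s⟫ = −(1−q)²(2−q)·ẑ(s)(ŷ(s) − (1−q)Z_0(s))`. [folklore] -/
theorem pairH_faceA_target (q : ℝ) (s : V5) :
    pairH q (bivFaceA q) (wedgeH (conv (edgeBC 0) s) (conv (edgeBC 1) s)) = -((1 - q) ^ 2 * (2 - q)) * (hz s * (hy s - (1 - q) * s.z0)) := by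
  simp only [pairH, bivFaceA, wedgeH, conv, edgeBC, hx, hy, hz, V5.total]; ring

/-- `⟪e_xv, s∧P_b s⟫ = (1−q)·x̂(s)v̂(s)`. [folklore] -/
theorem pairH_bivXV_target (q : ℝ) (s : V5) :
    pairH q bivXV (wedgeH (conv (edgeBC 0) s) (conv (edgeBC 1) s)) = (1 - q) * (hx s * s.total) := by
  simp only [pairH, bivXV, wedgeH, conv, edgeBC, hx, hy, hz, V5.total]; ring

/-- `⟪B, s∧P_b s⟫ ≤ 0` for every valid `s` (`0 ≤ q ≤ 1`). [folklore] -/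
theorem pairH_faceB_target_nonpos {q : ℝ} (hq0 : 0 ≤ q) (hq1 : q ≤ 1) {s : V5} (hs : Valid q s) :
    pairH q (bivFaceB q) (wedgeH (conv (edgeBC 0) s) (conv (edgeBC 1) s)) ≤ 0 := by
  rw [pairH_faceB_target]
  obtain ⟨h0, h1, h2, h3, h4⟩ := hs.nonneg
  have hk := hs.kapA
  have hxs : 0 ≤ hx s := by simp only [hx]; linarith
  have hzs : 0 ≤ hz s := by simp only [hz]; linarith
  have hq' : 0 ≤ 1 - q := sub_nonneg.2 hq1
  have hq'' : 0 ≤ 2 - q := by linarith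
  have : 0 ≤ (1 - q) * (2 - q) * (kap s + q * hx s * hz s) := by positivity
  linarith

/-- `⟪A, s∧P_b s⟫ ≤ 0` for every valid `s` (`0 ≤ q ≤ 1`). [folklore] -/
theorem pairH_faceA_target_nonpos {q : ℝ} (hq0 : 0 ≤ q) (hq1 : q ≤ 1) {s : V5} (hs : Valid q s) :
    pairH q (bivFaceA q) (wedgeH (conv (edgeBC 0) s) (conv (edgeBC 1) s)) ≤ 0 := by
  rw [pairH_faceA_target]
  obtain ⟨h0, h1, h2, h3, h4⟩ := hs.nonneg
  have hzs : 0 ≤ hz s := by simp only [hz]; linarith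
  have hys : 0 ≤ hy s - (1 - q) * s.z0 := by
    simp only [hy]; nlinarith
  have hq' : 0 ≤ 1 - q := sub_nonneg.2 hq1
  have hq'' : 0 ≤ 2 - q := by linarith
  have : 0 ≤ (1 - q) ^ 2 * (2 - q) * (hz s * (hy s - (1 - q) * s.z0)) := by positivity
  linarith

/-! ### The tower `(T_D T_a)^k` on the face tangent -/

/-- `(T_D ∘ T_a)^{k+1}(e_xv + m·T_deg) = q^{k+1}·e_xv + m·B`. [folklore] -/
theorem iterate_opTD_opTa_face (q m : ℝ) (k : ℕ) :
    (fun β => opTD q (opTa β))^[k + 1] (Biv.add bivXV (Biv.smul m (bivFaceT q))) =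
      Biv.add (Biv.smul (q ^ (k + 1)) bivXV) (Biv.smul m (bivFaceB q)) := by
  induction k with
  | zero =>
    simp only [zero_add, Function.iterate_one, pow_one]
    ext <;> simp only [opTD, opTa, bivFaceT, bivFaceB, bivXV, Biv.add, Biv.smul] <;> ring
  | succ k ih =>
    rw [Function.iterate_succ_apply', ih]
    ext <;> simp only [opTD, opTa, bivFaceB, bivXV, Biv.add, Biv.smul, pow_succ] <;> ring

/-- Against the `δ_0` target the tower pairs as `(1−q)·q·(q^k − m(2−q))`. [folklore] -/
theorem pairH_iterate_face_delta0 (q m : ℝ) (k : ℕ) :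
    pairH q ((fun β => opTD q (opTa β))^[k + 1] (Biv.add bivXV (Biv.smul m (bivFaceT q))))
      (wedgeH (conv (edgeBC 0) delta0) (conv (edgeBC 1) delta0)) = (1 - q) * q * (q ^ k - m * (2 - q)) := by
  rw [iterate_opTD_opTa_face]
  simp only [pairH, bivFaceB, bivXV, Biv.add, Biv.smul, wedgeH, conv, edgeBC, delta0, hx, hy, hz, V5.total]; ring

/-- **The obstruction.**  For `0 < q < 1`: any set of bivectors closed under `T_D` and `T_a` that contains a point `e_xv + m·T_deg` with `m > 0`
contains an element pairing NEGATIVELY with the `δ_0` target `δ_0 ∧ P_b δ_0` — so it cannot serve the termwise route.  (Every polyhedral cone containing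
the valid inputs contains such a point: memo FAR-CROSS-V §0(D).) [folklore] -/
theorem exists_neg_pairing_of_face_tangent_mem {q : ℝ} (hq0 : 0 < q) (hq1 : q < 1) {K : Set Biv}
    (hTD : ∀ β ∈ K, opTD q β ∈ K) (hTa : ∀ β ∈ K, opTa β ∈ K) {m : ℝ} (hm : 0 < m)
    (hmem : Biv.add bivXV (Biv.smul m (bivFaceT q)) ∈ K) :
    ∃ β ∈ K, pairH q β (wedgeH (conv (edgeBC 0) delta0) (conv (edgeBC 1) delta0)) < 0 := by
  have hm' : 0 < m * (2 - q) := mul_pos hm (by linarith)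
  obtain ⟨k, hk⟩ := exists_pow_lt_of_lt_one hm' hq1
  refine ⟨(fun β => opTD q (opTa β))^[k + 1] (Biv.add bivXV (Biv.smul m (bivFaceT q))), ?_, ?_⟩
  · -- membership by induction on the number of steps
    have step : ∀ β ∈ K, (fun β => opTD q (opTa β)) β ∈ K := fun β hβ => hTD _ (hTa β hβ)
    have : ∀ n : ℕ, (fun β => opTD q (opTa β))^[n] (Biv.add bivXV (Biv.smul m (bivFaceT q))) ∈ K := by
      intro n
      induction n with
      | zero => simpa using hmem
      | succ n ih => rw [Function.iterate_succ_apply']; exact step _ ih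
    exact this (k + 1)
  · rw [pairH_iterate_face_delta0]
    have h1 : 0 < 1 - q := sub_pos.2 hq1
    have h2 : q ^ k - m * (2 - q) < 0 := by linarith
    have : (1 - q) * q * (q ^ k - m * (2 - q)) < 0 := mul_neg_of_pos_of_neg (mul_pos h1 hq0) h2
    exact this

end ThreeApex

end FK

end Summit.CriticalPhenomena.PercolationContinuityZ3.Theorems
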